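import Mathlib.LinearAlgebra.Matrix.Charpoly.Coeff
import Mathlib.FieldTheory.IsAlgClosed.Basic
import Literature.LinearAlgebra.Matrix.CayleyCharpolyDiscr            -- ★ `charpoly_cayley_mul_C_det` (any size): `χ_{c(A)} · C det(1 − A) = det((T − 1)·1 − (T + 1)·A)`
import Literature.Algebra.Polynomial.DiscriminantRootProduct          -- ★ `discr_prod_X_sub_C_eq_prod_prod_Ioi_sq`: `disc(Π (X − ξ_i)) = Π_{i<j} (ξ_j − ξ_i)²`
import HarnessLib

/-!
# K2 · E3 ∕ U12-d kit — the Weyl discriminant through the Cayley chart, GENERAL rank, over an algebraically closed field: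
# `disc(χ_{c(A)}) · det(1 − A)^{2(N−1)} = 2^{N(N−1)} · disc(χ_A)`, `c(A) = (1 + A)(1 − A)⁻¹`

HCML Track B «K2-LIT», cell `pub/hodgecm-mathlib`, crux H413 = `stmt-HodgeConjecture-24833` (`--supports … --as helper`), seat `hodgecm-mathlib-K2E3-p12` (g0),
socket #12 `sig_K2E3NormalizedCharBddNearSemisimple` (dealer K2E3-plan (g1) DEALS BATCH #1: next rung (S-c) «Weyl discriminant along the Cayley slice»).  The tree has the
identity at `N = 3` only (★ `Literature.LinearAlgebra.Matrix.discr_charpoly_cayley_mul_det_pow_four`: `disc(χ_{c(X)})·det(1 − X)⁴ = 2⁶·disc(χ_X)`, by the explicit cubic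
discriminant).  THIS FILE proves it for EVERY `N` over an ALGEBRAICALLY CLOSED FIELD (the companion file `K2E3CayleyCharpolyDiscr` transfers it to every commutative
ring through the universal matrix); PROOF STRATEGY «roots»: if `χ_A = Π (T − ξ_i)` then `det(a·1 − b·A) = Π (a − bξ_i)` for all scalars `a, b` (§1), hence
`det((T−1)·1 − (T+1)·A) = Π ((1−ξ_i)T − (1+ξ_i))` (§2, equality of polynomials from equality of values at the infinitely many `t ≠ −1`), hence for `det(1 − A) = Π(1 − ξ_i) ≠ 0`
the characteristic polynomial of the Cayley transform is `Π (T − μ_i)`, `μ_i = (1+ξ_i)∕(1−ξ_i)` (§3), and `μ_j − μ_i = 2(ξ_j − ξ_i)∕((1−ξ_i)(1−ξ_j))` turns ★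
`disc(Π(T − ξ_i)) = Π_{i<j}(ξ_j − ξ_i)²` into the identity (§4, with the double-product bookkeeping `Π_{i<j} f_i f_j = (Π_i f_i)^{N−1}`).  Consumers: the weight
`√√‖u‖`, `u = disc(χ_g)∕det(g)^{N−1}`, of ★ `normalizedCharacter_locallyBounded` ∕ socket #12 read through the Cayley slice at a central point
(`u(c(Y))·det(1 − Y²)^{N−1} = 2^{N(N−1)}·disc(χ_Y)`), and the general-rank version of the «HC-D» road's group-to-Lie-algebra step (★ `F0P3cStCharTSHCDGroupToLie`, `N = 3`).
THEOREMS ONLY (no `def`, no instance, no notation, no `sorry`, axioms ⊆ the trio).  HONEST LABEL: pure algebra; HC_CM is proved only modulo the 7 printed citations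
(2 remaining named inputs: hLiu418 = stmt-HodgeConjecture-24832, h413 = stmt-HodgeConjecture-24833) until rung 0 closes.

## References
* [PlatonovRapinchuk1994] V. Platonov, A. Rapinchuk, *Algebraic Groups and Number Theory* (1994), §3.3 (the Cayley parametrisation `(1 + X)(1 − X)⁻¹`).
* [BasuPollackRoy2006] S. Basu, R. Pollack, M.-F. Roy, *Algorithms in Real Algebraic Geometry*, 2nd ed. (2006), Ch. 4 §4.1 (discriminant as `Π_{i<j}(x_i − x_j)²`).
* [HarishChandra1999AdmissibleDistributions] Harish-Chandra (DeBacker–Sally), *Admissible Invariant Distributions on Reductive p-adic Groups* (1999), §17 (`D_G`, `|η_𝔤(X)| = |D_G(exp X)|`).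
-/

set_option autoImplicit false
set_option linter.dupNamespace false

open Polynomial Finset

namespace Summit.HodgeConjecture.HodgeConjecture.Cruxes.H413.K2E3CayleyCharpolyDiscrField

/-! ## §0 Double products over `i < j` in `Fin N` -/

section Fin

variable {M : Type*} [CommMonoid M] {N : ℕ}

/-- `Π_i Π_{j>i} g j = Π_j (g j)^{#(Iio j)}` — swap the triangular double product. [folklore] -/
theorem prod_prod_Ioi_eq_prod_pow_card_Iio (g : Fin N → M) :
    ∏ i : Fin N, ∏ j ∈ Ioi i, g j = ∏ j : Fin N, g j ^ (Iio j).card := by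
  rw [Finset.prod_comm' (s := (univ : Finset (Fin N))) (t := fun i => Ioi i) (t' := (univ : Finset (Fin N))) (s' := fun j => Iio j)
    (h := fun i j => by simp only [mem_Iio, mem_univ, and_true, mem_Ioi, true_and])]
  exact Finset.prod_congr rfl fun j _ => Finset.prod_const _

/-- **`Π_{i<j} (f_i · f_j) = (Π_i f_i)^{N−1}`** on `Fin N`: each index occurs in exactly `N − 1` pairs (`#(Ioi i) + #(Iio i) = (N − 1 − i) + i`). [folklore] -/
theorem prod_prod_Ioi_mul_eq_pow (f : Fin N → M) :
    ∏ i : Fin N, ∏ j ∈ Ioi i, (f i * f j) = (∏ i : Fin N, f i) ^ (N - 1) := by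
  have h1 : ∏ i : Fin N, ∏ j ∈ Ioi i, (f i * f j) = (∏ i : Fin N, f i ^ (Ioi i).card) * ∏ i : Fin N, ∏ j ∈ Ioi i, f j := by
    rw [← Finset.prod_mul_distrib]
    exact Finset.prod_congr rfl fun i _ => by rw [Finset.prod_mul_distrib, Finset.prod_const]
  rw [h1, prod_prod_Ioi_eq_prod_pow_card_Iio, ← Finset.prod_mul_distrib, ← Finset.prod_pow]
  refine Finset.prod_congr rfl fun i _ => ?_
  rw [← pow_add, Fin.card_Ioi, Fin.card_Iio]
  congr 1
  have := i.2
  omega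

end Fin

/-! ## §1 `det(a·1 − b·A) = Π (a − b ξ_i)` when `χ_A = Π (T − ξ_i)` (scalars `a, b` of a field) -/

section Field

variable {L : Type*} [Field L] {N : ℕ}

/-- For `χ_A = Π_i (T − ξ_i)` and scalars `a, b`: `det(a·1 − b·A) = Π_i (a − b·ξ_i)` (`b = 0`: both sides `a^N`; `b ≠ 0`: `a·1 − b·A = b·((a∕b)·1 − A)` and Mathlib
`Matrix.eval_charpoly`). [cite: BasuPollackRoy2006, Ch. 4 §4.1] -/
theorem det_smul_one_sub_smul_eq_prod (A : Matrix (Fin N) (Fin N) L) (ξ : Fin N → L) (hξ : A.charpoly = ∏ i, (X - C (ξ i))) (a b : L) :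
    (a • (1 : Matrix (Fin N) (Fin N) L) - b • A).det = ∏ i, (a - b * ξ i) := by
  by_cases hb : b = 0
  · subst hb
    simp only [zero_smul, sub_zero, zero_mul, Matrix.det_smul, Matrix.det_one, mul_one, Fintype.card_fin, Finset.prod_const, Finset.card_univ]
  · have hfac : a • (1 : Matrix (Fin N) (Fin N) L) - b • A = b • ((a / b) • (1 : Matrix (Fin N) (Fin N) L) - A) := by
      rw [smul_sub, smul_smul, mul_div_cancel₀ a hb]
    have hev : ((a / b) • (1 : Matrix (Fin N) (Fin N) L) - A).det = ∏ i, (a / b - ξ i) := by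
      rw [Matrix.smul_one_eq_diagonal, ← Matrix.scalar_apply, ← Matrix.eval_charpoly, hξ, Polynomial.eval_prod]
      exact Finset.prod_congr rfl fun i _ => by rw [eval_sub, eval_X, eval_C]
    rw [hfac, Matrix.det_smul, hev, Fintype.card_fin]
    have hN : b ^ N = ∏ _i : Fin N, b := by rw [Finset.prod_const, Finset.card_univ, Fintype.card_fin]
    rw [hN, ← Finset.prod_mul_distrib]
    exact Finset.prod_congr rfl fun i _ => by rw [mul_sub, mul_div_cancel₀ a hb]

/-! ## §2 The cleared characteristic matrix of the Cayley transform factors: `det((T−1)·1 − (T+1)·A) = Π ((1−ξ_i)·T − (1+ξ_i))` -/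

/-- Evaluating `det((T−1)·1 − (T+1)·A)` at `t`: `det((t−1)·1 − (t+1)·A)`. [folklore] -/
theorem eval_det_cayleyCharmatrix (A : Matrix (Fin N) (Fin N) L) (t : L) :
    (((X - 1 : L[X]) • (1 : Matrix (Fin N) (Fin N) L[X]) - (X + 1 : L[X]) • A.map C).det).eval t =
      ((t - 1) • (1 : Matrix (Fin N) (Fin N) L) - (t + 1) • A).det := by
  rw [← Polynomial.coe_evalRingHom, RingHom.map_det]
  congr 1
  ext i j
  by_cases hij : i = j
  · subst hij
    simp only [RingHom.mapMatrix_apply, Matrix.map_apply, Matrix.sub_apply, Matrix.smul_apply, Matrix.one_apply_eq, smul_eq_mul, mul_one,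
      Polynomial.coe_evalRingHom, eval_sub, eval_mul, eval_add, eval_X, eval_one, eval_C]
  · simp only [RingHom.mapMatrix_apply, Matrix.map_apply, Matrix.sub_apply, Matrix.smul_apply, Matrix.one_apply_ne hij, smul_eq_mul, mul_zero,
      Polynomial.coe_evalRingHom, eval_sub, eval_mul, eval_add, eval_X, eval_one, eval_C, eval_zero]

/-- **`det((T−1)·1 − (T+1)·A) = Π_i ((1−ξ_i)·T − (1+ξ_i))`** in `L[T]` when `χ_A = Π (T − ξ_i)` and `L` is infinite: both sides take the value `Π((t−1) − (t+1)ξ_i)` at every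
`t ∈ L` (§1 with `a = t − 1`, `b = t + 1`), and a polynomial over an infinite field is determined by its values. [cite: PlatonovRapinchuk1994, §3.3] -/
theorem det_cayleyCharmatrix_eq_prod [Infinite L] (A : Matrix (Fin N) (Fin N) L) (ξ : Fin N → L) (hξ : A.charpoly = ∏ i, (X - C (ξ i))) :
    ((X - 1 : L[X]) • (1 : Matrix (Fin N) (Fin N) L[X]) - (X + 1 : L[X]) • A.map C).det = ∏ i, (C (1 - ξ i) * X - C (1 + ξ i)) := by
  apply Polynomial.funext
  intro t
  rw [eval_det_cayleyCharmatrix, det_smul_one_sub_smul_eq_prod A ξ hξ, Polynomial.eval_prod]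
  exact Finset.prod_congr rfl fun i _ => by
    rw [eval_sub, eval_mul, eval_C, eval_X, eval_C]; ring

/-! ## §3 The characteristic polynomial of the Cayley transform: `χ_{c(A)} = Π (T − μ_i)`, `μ_i = (1+ξ_i)∕(1−ξ_i)` -/

/-- `det(1 − A) = Π (1 − ξ_i)` when `χ_A = Π (T − ξ_i)` (§1 with `a = b = 1`). [folklore] -/
theorem det_one_sub_eq_prod (A : Matrix (Fin N) (Fin N) L) (ξ : Fin N → L) (hξ : A.charpoly = ∏ i, (X - C (ξ i))) :
    (1 - A).det = ∏ i, (1 - ξ i) := by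
  have h := det_smul_one_sub_smul_eq_prod A ξ hξ 1 1
  simp only [one_smul, one_mul] at h
  exact h

/-- **`χ_{c(A)} = Π_i (T − μ_i)`, `μ_i = (1 + ξ_i)∕(1 − ξ_i)`**, for `χ_A = Π (T − ξ_i)` with `det(1 − A) ≠ 0` (i.e. no `ξ_i = 1`): the roots of the Cayley transform are
the Möbius images of the roots (★ `charpoly_cayley_mul_C_det` + §2, cancelling `C det(1 − A)` in the domain `L[T]`). [cite: PlatonovRapinchuk1994, §3.3] -/
theorem charpoly_cayley_eq_prod [Infinite L] (A : Matrix (Fin N) (Fin N) L) (ξ : Fin N → L) (hξ : A.charpoly = ∏ i, (X - C (ξ i)))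
    (h : (1 - A).det ≠ 0) :
    ((1 + A) * (1 - A)⁻¹).charpoly = ∏ i, (X - C ((1 + ξ i) / (1 - ξ i))) := by
  have hd := det_one_sub_eq_prod A ξ hξ
  have hi : ∀ i, 1 - ξ i ≠ 0 := fun i => by
    intro h0
    apply h
    rw [hd]
    exact Finset.prod_eq_zero (Finset.mem_univ i) h0
  have hmain := Literature.LinearAlgebra.Matrix.charpoly_cayley_mul_C_det A (isUnit_iff_ne_zero.2 h)
  rw [det_cayleyCharmatrix_eq_prod A ξ hξ] at hmain
  have hfac : ∏ i, (C (1 - ξ i) * X - C (1 + ξ i)) = (∏ i, (X - C ((1 + ξ i) / (1 - ξ i)))) * C (1 - A).det := by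
    rw [hd, map_prod C, ← Finset.prod_mul_distrib]
    refine Finset.prod_congr rfl fun i _ => ?_
    rw [sub_mul, ← C_mul, div_mul_cancel₀ _ (hi i), mul_comm X (C (1 - ξ i))]
  rw [hfac] at hmain
  exact mul_right_cancel₀ (by rwa [Ne, Polynomial.C_eq_zero]) hmain

/-! ## §4 The discriminant identity over an algebraically closed field -/

/-- **`disc(χ_{c(A)}) · det(1 − A)^{2(N−1)} = 2^{N(N−1)} · disc(χ_A)`** for `χ_A = Π (T − ξ_i)` split and `det(1 − A) ≠ 0` (★ `discr_prod_X_sub_C_eq_prod_prod_Ioi_sq` on both sides;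
`μ_j − μ_i = 2(ξ_j − ξ_i)∕((1−ξ_i)(1−ξ_j))`; `Π_{i<j}((1−ξ_i)(1−ξ_j))² = det(1 − A)^{2(N−1)}` and `Π_{i<j} 2·2 = 2^{N(N−1)}` by `prod_prod_Ioi_mul_eq_pow`).
[cite: BasuPollackRoy2006, Ch. 4 §4.1] [cite: PlatonovRapinchuk1994, §3.3] -/
theorem discr_charpoly_cayley_mul_det_pow_of_eq_prod [Infinite L] (A : Matrix (Fin N) (Fin N) L) (ξ : Fin N → L)
    (hξ : A.charpoly = ∏ i, (X - C (ξ i))) (h : (1 - A).det ≠ 0) :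
    ((1 + A) * (1 - A)⁻¹).charpoly.discr * (1 - A).det ^ (2 * (N - 1)) = 2 ^ (N * (N - 1)) * A.charpoly.discr := by
  have hd := det_one_sub_eq_prod A ξ hξ
  have hi : ∀ i, 1 - ξ i ≠ 0 := fun i => by
    intro h0
    apply h
    rw [hd]
    exact Finset.prod_eq_zero (Finset.mem_univ i) h0
  rw [charpoly_cayley_eq_prod A ξ hξ h, hξ,
    Literature.Algebra.Polynomial.DiscriminantRootProduct.discr_prod_X_sub_C_eq_prod_prod_Ioi_sq,
    Literature.Algebra.Polynomial.DiscriminantRootProduct.discr_prod_X_sub_C_eq_prod_prod_Ioi_sq, hd]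
  -- `Π_{i<j} (μ_j − μ_i)² · (Π_i (1−ξ_i))^{2(N−1)} = 2^{N(N−1)} · Π_{i<j} (ξ_j − ξ_i)²`
  have hμ : ∀ i j, (1 + ξ j) / (1 - ξ j) - (1 + ξ i) / (1 - ξ i) = 2 * (ξ j - ξ i) / ((1 - ξ i) * (1 - ξ j)) := by
    intro i j
    rw [div_sub_div _ _ (hi j) (hi i), mul_comm (1 - ξ j) (1 - ξ i)]
    congr 1
    ring
  have hsq : (∏ i : Fin N, (1 - ξ i)) ^ (2 * (N - 1)) = ∏ i : Fin N, ∏ j ∈ Ioi i, ((1 - ξ i) * (1 - ξ j)) ^ 2 := by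
    rw [mul_comm 2, pow_mul, ← prod_prod_Ioi_mul_eq_pow, ← Finset.prod_pow]
    exact Finset.prod_congr rfl fun i _ => (Finset.prod_pow _ _ _).symm
  have htwo : (2 : L) ^ (N * (N - 1)) = ∏ i : Fin N, ∏ j ∈ Ioi i, ((2 : L) * 2) := by
    rw [prod_prod_Ioi_mul_eq_pow, Finset.prod_const, Finset.card_univ, Fintype.card_fin, ← pow_mul]
  rw [hsq, htwo, ← Finset.prod_mul_distrib, ← Finset.prod_mul_distrib]
  refine Finset.prod_congr rfl fun i _ => ?_
  rw [← Finset.prod_mul_distrib, ← Finset.prod_mul_distrib]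
  refine Finset.prod_congr rfl fun j _ => ?_
  rw [hμ i j, div_pow, mul_pow, div_mul_cancel₀ _ (pow_ne_zero 2 (mul_ne_zero (hi i) (hi j)))]
  ring

/-- Roots of a monic polynomial that splits, enumerated by `Fin` of its degree. [folklore] -/
theorem exists_eq_prod_X_sub_C_of_splits {f : L[X]} (hf : f.Splits) (hm : f.Monic) {N : ℕ} (hN : f.natDegree = N) :
    ∃ ξ : Fin N → L, f = ∏ i, (X - C (ξ i)) := by
  classical
  obtain ⟨l, hl⟩ := Quotient.exists_rep f.roots
  have hlen : l.length = N := by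
    rw [← hN, ← splits_iff_card_roots.1 hf, ← hl]
    rfl
  refine ⟨fun i => l.get (Fin.cast hlen.symm i), ?_⟩
  have hprod : f = (f.roots.map (X - C ·)).prod := hf.eq_prod_roots_of_monic hm
  have hlist : (∏ i : Fin N, (X - C (l.get (Fin.cast hlen.symm i)))) = (l.map (X - C ·)).prod := by
    subst hlen
    have hfun : (fun i : Fin l.length => X - C (l.get (Fin.cast rfl i))) = (fun a : L => X - C a) ∘ (fun i : Fin l.length => l[(i : ℕ)]) := by
      funext i
      simp only [Function.comp_apply, List.get_eq_getElem, Fin.val_cast]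
    rw [← List.prod_ofFn, hfun, ← List.map_ofFn, List.ofFn_getElem]
  rw [hlist]
  refine hprod.trans ?_
  rw [← hl]
  rfl

/-- **The Weyl discriminant through the Cayley chart, any rank, algebraically closed field**: `disc(χ_{c(A)}) · det(1 − A)^{2(N−1)} = 2^{N(N−1)} · disc(χ_A)` for every
`A ∈ M_N(L)` with `det(1 − A) ≠ 0`, `c(A) = (1 + A)(1 − A)⁻¹`. [cite: BasuPollackRoy2006, Ch. 4 §4.1] [cite: PlatonovRapinchuk1994, §3.3] [cite: HarishChandra1999AdmissibleDistributions, §17] -/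
theorem discr_charpoly_cayley_mul_det_pow_of_isAlgClosed [IsAlgClosed L] (A : Matrix (Fin N) (Fin N) L) (h : (1 - A).det ≠ 0) :
    ((1 + A) * (1 - A)⁻¹).charpoly.discr * (1 - A).det ^ (2 * (N - 1)) = 2 ^ (N * (N - 1)) * A.charpoly.discr := by
  haveI : Infinite L := IsAlgClosed.instInfinite
  obtain ⟨ξ, hξ⟩ := exists_eq_prod_X_sub_C_of_splits (IsAlgClosed.splits A.charpoly) (Matrix.charpoly_monic A)
    (by rw [Matrix.charpoly_natDegree_eq_dim, Fintype.card_fin])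
  exact discr_charpoly_cayley_mul_det_pow_of_eq_prod A ξ hξ h

end Field

end Summit.HodgeConjecture.HodgeConjecture.Cruxes.H413.K2E3CayleyCharpolyDiscrField
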